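import Summits.Ventures.CertifiedArithmetic.LowPrec.ExactCriteria

/-!
# THEOREMS-R1 Theorem S / S′ at parameter level: the necessary side, for every format triple

HONEST FRAMING (venture CertifiedArithmetic / cell `pub-lowprec`): certified error envelopes and
provably optimal rounding/accumulation schemes for low-precision formats under stated cost models;
every table by two implementations; no hardware or vendor claims.

`ExactCriteria.lean` proves the SUFFICIENT side of the exact-sum criterion for every format triple
(`exactSums_of_spanSides`: (i) `qexp_R ≤ min(qexp₁, qexp₂)`, (ii′) the two span inequalities,
(iii) `maxRat₁ + maxRat₂ ≤ maxRat_R`) and the witness PRINCIPLES `not_exactSums_of_witness` /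
`not_exactSums_of_overflow`, which the per-key verdict files instantiate with explicit data. This
file states the NECESSARY side once and for all, quantified over the formats (def-free):

* `not_exactSums_of_qexp_lt_left` / `_right` — Theorem S′(b) for every triple: if an operand
  format has a nonzero value (`1 ≤ maxScaled`) and a finer quantum than `R`, its least positive
  value plus `0` is not a value of `R`. Hence hypothesis (i) of Theorem S is NECESSARY.
* `not_exactSums_of_maxRat_lt` — hypothesis (iii) is NECESSARY (the two maxima overflow).
* `exactSums_necessary` — packaging: `ExactSums φ₁ φ₂ ψ → (i) ∧ (iii)` for all operand formats
  with a nonzero value.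
* `not_exactSums_of_pow_witness` — Theorem S′(a) for every triple: powers of two `2^k ∈ F₁`,
  `2^l ∈ F₂` with `|k - l| = P_R` refute `ExactSums` (their sum is `(2^P_R + 1) · 2^min(k,l)`, odd
  significand of `P_R + 1` bits); the in-range clause `2^k + 2^l ≤ M_R` of the printed statement
  only classifies the failure as a precision (not range) failure and is not needed.

The span hypothesis (ii′) itself is sufficient but NOT necessary in general (degenerate formats:
`F₁ = {0, 1}`, `F₂ = {0, 1, 2, 3}` into a `P_R = 2` format containing `{0, …, 4}` has all sums
exact while both span inequalities fail with equality), which is why the cell decides the keys on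
which (ii′) fails by explicit witnesses (S′) rather than by a converse.
-/

namespace Summit.Ventures.CertifiedArithmetic

open Literature.ComputerArithmetic.FloatingPoint
open Literature.ComputerArithmetic.FloatingPoint.MiniFloat
open Literature.ComputerArithmetic.FloatingPoint.Format

/-- The least positive value of a format with a nonzero value: the datum of magnitude one quantum
has value `quantum = 2^qexp`. [folklore] -/
theorem toRat_ofScaled_one {φ : Format} (h : 1 ≤ φ.maxScaled) :
    (ofScaled φ false 1 h).toRat = (2 : ℚ) ^ φ.qexp := by
  have hr : φ.Representable 1 := representable_of_lt_pow (Nat.one_lt_two_pow (by omega)) h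
  rw [toRat_ofScaled h hr]
  simp [Format.quantum]

/-- The largest value: the datum of magnitude `maxScaled` has value `maxRat`. [folklore] -/
theorem toRat_ofScaled_maxScaled (φ : Format) :
    (ofScaled φ false φ.maxScaled le_rfl).toRat = φ.maxRat := by
  rw [toRat_ofScaled le_rfl (representable_maxScaled φ)]
  simp [Format.maxRat]

/-- THEOREMS-R1 Theorem S′(b), every triple — hypothesis (i) of Theorem S is NECESSARY on the left:
if `φ₁` has a nonzero value and `qexp₁ < qexp_R`, the sum `2^qexp₁ + 0` is not a value of `ψ`. -/
theorem not_exactSums_of_qexp_lt_left {φ₁ φ₂ ψ : Format} (h₁ : 1 ≤ φ₁.maxScaled)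
    (hq : φ₁.qexp < ψ.qexp) : ¬ ExactSums φ₁ φ₂ ψ := by
  refine not_exactSums_of_witness (ofScaled φ₁ false 1 h₁) (MiniFloat.zero φ₂) 1 φ₁.qexp odd_one
    ?_ (Or.inl hq)
  rw [toRat_ofScaled_one h₁, toRat_zero]; simp

/-- THEOREMS-R1 Theorem S′(b), every triple — hypothesis (i) is NECESSARY on the right. -/
theorem not_exactSums_of_qexp_lt_right {φ₁ φ₂ ψ : Format} (h₂ : 1 ≤ φ₂.maxScaled)
    (hq : φ₂.qexp < ψ.qexp) : ¬ ExactSums φ₁ φ₂ ψ := by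
  refine not_exactSums_of_witness (MiniFloat.zero φ₁) (ofScaled φ₂ false 1 h₂) 1 φ₂.qexp odd_one
    ?_ (Or.inl hq)
  rw [toRat_ofScaled_one h₂, toRat_zero]; simp

/-- Hypothesis (iii) of Theorem S is NECESSARY, every triple: if `maxRat₁ + maxRat₂ > maxRat_R`
the sum of the two largest values overflows `ψ`. -/
theorem not_exactSums_of_maxRat_lt {φ₁ φ₂ ψ : Format} (h : ψ.maxRat < φ₁.maxRat + φ₂.maxRat) :
    ¬ ExactSums φ₁ φ₂ ψ :=
  not_exactSums_of_overflow (ofScaled φ₁ false φ₁.maxScaled le_rfl)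
    (ofScaled φ₂ false φ₂.maxScaled le_rfl)
    (by rwa [toRat_ofScaled_maxScaled, toRat_ofScaled_maxScaled])

/-- THEOREMS-R1 Theorem S, NECESSARY SIDE, every triple: if every sum of values of `φ₁` and `φ₂`
(formats with a nonzero value) is a value of `ψ`, then (i) `qexp_R ≤ min(qexp₁, qexp₂)` and (iii)
`maxRat₁ + maxRat₂ ≤ maxRat_R`. (The span hypothesis (ii′) of `exactSums_of_spanSides` is
sufficient but not necessary; see the module docstring.) -/
theorem exactSums_necessary {φ₁ φ₂ ψ : Format} (h₁ : 1 ≤ φ₁.maxScaled) (h₂ : 1 ≤ φ₂.maxScaled)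
    (h : ExactSums φ₁ φ₂ ψ) :
    ψ.qexp ≤ min φ₁.qexp φ₂.qexp ∧ φ₁.maxRat + φ₂.maxRat ≤ ψ.maxRat := by
  refine ⟨le_min ?_ ?_, ?_⟩
  · by_contra hlt
    exact not_exactSums_of_qexp_lt_left h₁ (not_le.mp hlt) h
  · by_contra hlt
    exact not_exactSums_of_qexp_lt_right h₂ (not_le.mp hlt) h
  · by_contra hlt
    exact not_exactSums_of_maxRat_lt (not_le.mp hlt) h

/-- THEOREMS-R1 Theorem S′(a), every triple: values `x = 2^k ∈ F₁`, `y = 2^l ∈ F₂` whose exponents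
differ by exactly `P_R` refute `ExactSums φ₁ φ₂ ψ` — their sum `(2^P_R + 1) · 2^min(k, l)` has an
odd significand of `P_R + 1` bits (`not_exactSums_of_witness`). No range clause is needed. -/
theorem not_exactSums_of_pow_witness {φ₁ φ₂ ψ : Format} (x : MiniFloat φ₁) (y : MiniFloat φ₂)
    {k l : ℤ} (hx : x.toRat = (2 : ℚ) ^ k) (hy : y.toRat = (2 : ℚ) ^ l)
    (hkl : k = l + (ψ.manBits + 1 : ℕ) ∨ l = k + (ψ.manBits + 1 : ℕ)) : ¬ ExactSums φ₁ φ₂ ψ := by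
  have hodd : Odd (2 ^ (ψ.manBits + 1) + 1) := Even.add_one (Nat.even_pow.mpr ⟨even_two, by omega⟩)
  have h2 : (2 : ℚ) ≠ 0 := two_ne_zero
  rcases hkl with hkl | hkl
  · refine not_exactSums_of_witness x y (2 ^ (ψ.manBits + 1) + 1) l hodd ?_ (Or.inr (by omega))
    rw [hx, hy, hkl, zpow_add₀ h2, zpow_natCast]; push_cast; ring
  · refine not_exactSums_of_witness x y (2 ^ (ψ.manBits + 1) + 1) k hodd ?_ (Or.inr (by omega))
    rw [hx, hy, hkl, zpow_add₀ h2, zpow_natCast]; push_cast; ring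

/-- A non-degenerate instance of S′(a) WITHOUT enumeration or a hand-computed sum: `e2m1 + e2m3 →
e2m3` is inexact because `4 = 2^2 ∈ e2m1`, `1/4 = 2^-2 ∈ e2m3` and `2 - (-2) = 4 = P_R`. -/
example : ¬ ExactSums E2M1 E2M3 E2M3 :=
  not_exactSums_of_pow_witness (ψ := E2M3) (ofScaled E2M1 false 8 (by decide))
    (ofScaled E2M3 false 2 (by decide)) (k := 2) (l := -2) (by decide +kernel) (by decide +kernel)
    (Or.inl (by decide))

end Summit.Ventures.CertifiedArithmetic
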